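import Literature.Topology.PlaneTopology.Janiszewski
import Literature.Topology.PlaneTopology.BandCrossing
import Mathlib.Analysis.Complex.Convex
import Mathlib.Topology.MetricSpace.Thickening
import HarnessLib

/-!
# Crossings of a rectangle: continua versus paths, and the dual path

Topic: Topology / PlaneTopology.  Two planar lemmas about the closed rectangle
`R = [a, b] × [c, d] = Icc a b ×ℂ Icc c d`, which are the topological input of the
Russo–Seymour–Welsh "lowest crossing / dual crossing" arguments when these are run for continuum
crossings (Schramm–Smirnov, *On the scaling limits of planar percolation* (2011), §1.3: "a
crossing of `Q` is a connected compact subset of `[Q]` that intersects both opposite sides";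
proof of Lemma 6.1: "hence there is a dual closed crossing"):

* `exists_mem_of_isPreconnected_crossing` — **the crossing lemma for a continuum and a path**:
  a compact connected `K ⊆ R` meeting the two vertical sides meets every path in `R` joining the
  two horizontal sides.  (The tree's `exists_mem_of_crossing`, `Brouwer.lean`, is the case of
  two paths; we thicken `K` slightly, join its two side points by a path inside the thickening —
  open connected subsets of `ℂ` are path connected — clamp that path back into `R` with the
  `1`-Lipschitz coordinatewise retraction `exists_retraction_reProdIm`, and apply the two-path
  lemma.)
* `exists_path_avoiding_of_not_crossed` — **the dual path**: if a compact `𝒦 ⊆ R` contains no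
  connected set meeting both vertical sides, then some path in `R` joins the two horizontal
  sides inside `R ∖ 𝒦`.  (Cut-wire theorem `exists_closed_separation`: `𝒦 = Z₁ ⊔ Z₂` with `Z₁`
  off the right side and `Z₂` off the left side; Janiszewski's theorem `janiszewski'` for
  `A = Z₁ ∪ ({a} × [c-1, d+1]) ∪ E` and `B = Z₂ ∪ ({b} × [c-1, d+1]) ∪ E`, `E` a closed square
  frame at distance `1` around `R`, `A ∩ B = E` connected, neither separating a point above `R`
  from a point below `R` (go round through the right, resp. left, margin); a path joining them
  off `A ∪ B` stays inside the frame and strictly between the lines `re = a`, `re = b`, and its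
  piece between the last visit to `im ≥ d` and the next visit to `im ≤ c` is the dual path.)

Together they give the continuum form of planar duality in a rectangle ("either an open
left-right crossing or a closed top-bottom crossing"), with no lattice structure.

## References

* O. Schramm, S. Smirnov, Ann. Probab. 39 (2011), §1.3 and proof of Lemma 6.1. [SchrammSmirnov2011]
* Ch. Pommerenke, *Boundary Behaviour of Conformal Maps* (1992), §1.1 (Janiszewski).
  [PommerenkeBBCM1992]
* K. Kuratowski, *Topology* II (1968), §47.II Thm. 3 (cut-wire theorem).
-/

noncomputable section

namespace Literature.Topology.PlaneTopology

open Complex Set Metric Filter Function _root_.Topology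

variable {a b c d : ℝ}

/-! ### Auxiliary: paths in open sets, a Lipschitz retraction, convexity of rectangles -/

/-- Two points of a preconnected subset of an open set `U ⊆ ℂ` are joined by a path in `U`
(the connected component of `U` containing them is open, hence path connected). [folklore] -/
theorem joinedIn_of_isPreconnected {U S : Set ℂ} (hU : IsOpen U) (hS : IsPreconnected S)
    (hSU : S ⊆ U) {p q : ℂ} (hp : p ∈ S) (hq : q ∈ S) : JoinedIn U p q := by
  have hpU : p ∈ U := hSU hp
  have hq' : q ∈ connectedComponentIn U p := hS.subset_connectedComponentIn hp hSU hq
  have hconn : IsConnected (connectedComponentIn U p) :=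
    ⟨⟨p, mem_connectedComponentIn hpU⟩, isPreconnected_connectedComponentIn⟩
  have hpath : IsPathConnected (connectedComponentIn U p) :=
    hU.connectedComponentIn.isConnected_iff_isPathConnected.mp hconn
  exact (hpath.joinedIn p (mem_connectedComponentIn hpU) q hq').mono
    (connectedComponentIn_subset U p)

/-- The coordinatewise clamp onto `[a, b] × [c, d]` is a continuous `1`-Lipschitz retraction
(it is the metric projection onto the closed convex rectangle). [folklore] -/
theorem exists_retraction_reProdIm (hab : a ≤ b) (hcd : c ≤ d) :
    ∃ ρ : ℂ → ℂ, Continuous ρ ∧ (∀ z, ρ z ∈ Icc a b ×ℂ Icc c d) ∧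
      (∀ z ∈ Icc a b ×ℂ Icc c d, ρ z = z) ∧ ∀ z w, dist (ρ z) (ρ w) ≤ dist z w := by
  refine ⟨fun z => ((projIcc a b hab z.re : ℝ) : ℂ) + ((projIcc c d hcd z.im : ℝ) : ℂ) * I,
    ?_, fun z => ?_, fun z hz => ?_, fun z w => ?_⟩
  · exact (continuous_ofReal.comp (continuous_subtype_val.comp
      (continuous_projIcc.comp continuous_re))).add
      ((continuous_ofReal.comp (continuous_subtype_val.comp
        (continuous_projIcc.comp continuous_im))).mul continuous_const)
  · rw [mem_reProdIm]
    have h1 := (projIcc a b hab z.re).2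
    have h2 := (projIcc c d hcd z.im).2
    simp only [add_re, ofReal_re, mul_re, I_re, mul_zero, ofReal_im, I_im, mul_one, sub_self,
      add_zero, add_im, mul_im, zero_add]
    exact ⟨h1, h2⟩
  · rw [mem_reProdIm] at hz
    apply Complex.ext
    · simp [projIcc_of_mem hab hz.1]
    · simp [projIcc_of_mem hcd hz.2]
  · rw [dist_eq_norm, dist_eq_re_im]
    have h : (((projIcc a b hab z.re : ℝ) : ℂ) + ((projIcc c d hcd z.im : ℝ) : ℂ) * I) -
        (((projIcc a b hab w.re : ℝ) : ℂ) + ((projIcc c d hcd w.im : ℝ) : ℂ) * I) =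
        (((projIcc a b hab z.re : ℝ) - (projIcc a b hab w.re : ℝ) : ℝ) : ℂ) +
          (((projIcc c d hcd z.im : ℝ) - (projIcc c d hcd w.im : ℝ) : ℝ) : ℂ) * I := by
      push_cast; ring
    rw [h, norm_add_mul_I]
    exact Real.sqrt_le_sqrt (add_le_add (sq_le_sq.mpr (abs_projIcc_sub_projIcc (h := hab)))
      (sq_le_sq.mpr (abs_projIcc_sub_projIcc (h := hcd))))

/-- Closed rectangles are convex. [folklore] -/
theorem convex_Icc_reProdIm_Icc (a b c d : ℝ) : Convex ℝ (Icc a b ×ℂ Icc c d) := by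
  rw [← (convex_Icc (𝕜 := ℝ) a b).convexHull_eq, ← (convex_Icc (𝕜 := ℝ) c d).convexHull_eq,
    ← Complex.convexHull_reProdIm]
  exact convex_convexHull ℝ _

/-! ### The crossing lemma for a continuum and a path -/

/-- **Crossing lemma (continuum versus path).**  Let `K ⊆ [a, b] × [c, d]` be compact and
connected, meeting the left side `re = a` and the right side `re = b`, and let `β` be a path
in the rectangle from the bottom side (`im (β 0) = c`) to the top side (`im (β 1) = d`).  Then
`β` meets `K`.  (Schramm–Smirnov's crossings are such continua; this is why a "dual" path
between the other two sides excludes a crossing.)  Proof: if not, `K` and `β([0,1])` are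
disjoint compact sets, hence have disjoint `ε`-thickenings; join the two side points of `K` by
a path inside the (open, connected) `ε`-thickening of `K`, clamp it into the rectangle by the
`1`-Lipschitz retraction (which fixes `K`, so the clamped path stays within `ε` of `K`), and
apply the two-path crossing lemma `exists_mem_of_crossing`.
[cite: SchrammSmirnov2011, §1.3 (crossings) and proof of Lemma 6.1] -/
theorem exists_mem_of_isPreconnected_crossing {K : Set ℂ} {β : ℝ → ℂ} (hab : a ≤ b)
    (hcd : c ≤ d) (hK : IsCompact K) (hKc : IsPreconnected K)
    (hKsub : K ⊆ Icc a b ×ℂ Icc c d) (hKa : ∃ z ∈ K, z.re = a) (hKb : ∃ z ∈ K, z.re = b)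
    (hβ : ContinuousOn β (Icc 0 1)) (hβK : MapsTo β (Icc 0 1) (Icc a b ×ℂ Icc c d))
    (hβ0 : (β 0).im = c) (hβ1 : (β 1).im = d) :
    ∃ t ∈ Icc (0 : ℝ) 1, β t ∈ K := by
  by_contra! hne
  obtain ⟨za, hza, hzare⟩ := hKa
  obtain ⟨zb, hzb, hzbre⟩ := hKb
  set P := β '' Icc 0 1 with hP
  have hPc : IsCompact P := isCompact_Icc.image_of_continuousOn hβ
  have hdisj : Disjoint K P := by
    rw [Set.disjoint_left]
    rintro z hzK ⟨t, ht, rfl⟩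
    exact hne t ht hzK
  obtain ⟨ε, hε, hthick⟩ := hdisj.exists_thickenings hK hPc.isClosed
  have hKN : K ⊆ thickening ε K := self_subset_thickening hε K
  obtain ⟨γ₀, hγ₀⟩ : JoinedIn (thickening ε K) za zb :=
    joinedIn_of_isPreconnected isOpen_thickening hKc hKN hza hzb
  obtain ⟨ρ, hρc, hρmem, hρid, hρlip⟩ := exists_retraction_reProdIm hab hcd
  set γ : ℝ → ℂ := fun s => ρ (γ₀.extend s) with hγ
  have hγc : Continuous γ := hρc.comp γ₀.continuous_extend
  have hγ0 : (γ 0).re = a := by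
    simp only [hγ, Path.extend_zero]
    rw [hρid za (hKsub hza), hzare]
  have hγ1 : (γ 1).re = b := by
    simp only [hγ, Path.extend_one]
    rw [hρid zb (hKsub hzb), hzbre]
  obtain ⟨s, hs, t, ht, hst⟩ := exists_mem_of_crossing hβ hγc.continuousOn hβK
    (fun s _ => hρmem _) hβ0 hβ1 hγ0 hγ1
  have hγs : γ s ∈ thickening ε K := by
    have hmem : γ₀.extend s ∈ thickening ε K := by
      rw [Path.extend_apply γ₀ hs]
      exact hγ₀ _
    obtain ⟨k, hk, hdist⟩ := mem_thickening_iff.1 hmem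
    refine mem_thickening_iff.2 ⟨k, hk, ?_⟩
    calc dist (γ s) k = dist (ρ (γ₀.extend s)) (ρ k) := by rw [hρid k (hKsub hk)]
      _ ≤ dist (γ₀.extend s) k := hρlip _ _
      _ < ε := hdist
  have hβt : β t ∈ thickening ε P := self_subset_thickening hε P ⟨t, ht, rfl⟩
  exact Set.disjoint_left.1 hthick hγs (hst ▸ hβt)

/-! ### The dual path of a compact set without crossings -/

/-- **The dual path.**  Let `𝒦 ⊆ R = [a, b] × [c, d]` (`a < b`, `c < d`) be compact, and suppose
that no connected subset of `𝒦` meets both vertical sides `re = a` and `re = b` of `R`.  Then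
some path in `R` joins the bottom side to the top side without meeting `𝒦`.  This is the
continuum half of planar duality in a rectangle ("no open left–right crossing, hence a dual
closed top–bottom crossing", Schramm–Smirnov, proof of Lemma 6.1), proved from the cut-wire
theorem and Janiszewski's theorem as explained in the module docstring.
[cite: SchrammSmirnov2011, proof of Lemma 6.1 ("hence there is a dual closed crossing")] -/
theorem exists_path_avoiding_of_not_crossed {𝒦 : Set ℂ} (hab : a < b) (hcd : c < d)
    (h𝒦 : IsCompact 𝒦) (h𝒦sub : 𝒦 ⊆ Icc a b ×ℂ Icc c d)
    (h : ∀ C ⊆ 𝒦, IsPreconnected C → (∃ z ∈ C, z.re = a) → (∃ z ∈ C, z.re = b) → False) :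
    ∃ γ : ℝ → ℂ, ContinuousOn γ (Icc 0 1) ∧ MapsTo γ (Icc 0 1) (Icc a b ×ℂ Icc c d) ∧
      (γ 0).im = c ∧ (γ 1).im = d ∧ ∀ t ∈ Icc (0 : ℝ) 1, γ t ∉ 𝒦 := by
  -- Step 1: cut-wire
  obtain ⟨Z₁, Z₂, hZ₁, hZ₂, hZdisj, hZunion, hZ₁b, hZ₂a⟩ :=
    exists_closed_separation (A := {z : ℂ | z.re = a}) (B := {z : ℂ | z.re = b}) h𝒦
      (isClosed_eq continuous_re continuous_const) (isClosed_eq continuous_re continuous_const)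
      (fun C hC hCc hCa hCb => h C hC hCc hCa hCb)
  have hZ₁sub : Z₁ ⊆ 𝒦 := hZunion ▸ subset_union_left
  have hZ₂sub : Z₂ ⊆ 𝒦 := hZunion ▸ subset_union_right
  have hZ₁c : IsCompact Z₁ := h𝒦.of_isClosed_subset hZ₁ hZ₁sub
  have hZ₂c : IsCompact Z₂ := h𝒦.of_isClosed_subset hZ₂ hZ₂sub
  -- Step 2: the frame `E`, the extended sides, the sets `A`, `B`
  set ET : Set ℂ := Icc (a - 2) (b + 2) ×ℂ Icc (d + 1) (d + 2) with hET
  set EL : Set ℂ := Icc (a - 2) (a - 1) ×ℂ Icc (c - 2) (d + 2) with hEL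
  set EB : Set ℂ := Icc (a - 2) (b + 2) ×ℂ Icc (c - 2) (c - 1) with hEB
  set ER : Set ℂ := Icc (b + 1) (b + 2) ×ℂ Icc (c - 2) (d + 2) with hER
  set E : Set ℂ := ((ET ∪ EL) ∪ EB) ∪ ER with hE
  set Lp : Set ℂ := {a} ×ℂ Icc (c - 1) (d + 1) with hLp
  set Rp : Set ℂ := {b} ×ℂ Icc (c - 1) (d + 1) with hRp
  set A : Set ℂ := (Z₁ ∪ Lp) ∪ E with hA
  set B : Set ℂ := (Z₂ ∪ Rp) ∪ E with hB
  have hrc : ∀ a' b' c' d' : ℝ, IsCompact (Icc a' b' ×ℂ Icc c' d') := fun a' b' c' d' =>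
    Metric.isCompact_of_isClosed_isBounded (isClosed_Icc.reProdIm isClosed_Icc)
      ((isBounded_Icc _ _).reProdIm (isBounded_Icc _ _))
  have hEc : IsCompact E :=
    (((hrc _ _ _ _).union (hrc _ _ _ _)).union (hrc _ _ _ _)).union (hrc _ _ _ _)
  have hLpc : IsCompact Lp := Metric.isCompact_of_isClosed_isBounded
    (isClosed_singleton.reProdIm isClosed_Icc) (Bornology.isBounded_singleton.reProdIm
      (isBounded_Icc _ _))
  have hRpc : IsCompact Rp := Metric.isCompact_of_isClosed_isBounded
    (isClosed_singleton.reProdIm isClosed_Icc) (Bornology.isBounded_singleton.reProdIm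
      (isBounded_Icc _ _))
  have hAc : IsCompact A := (hZ₁c.union hLpc).union hEc
  have hBc : IsCompact B := (hZ₂c.union hRpc).union hEc
  -- coordinates of points of `E`
  have hEout : ∀ w ∈ E, d + 1 ≤ w.im ∨ w.im ≤ c - 1 ∨ w.re ≤ a - 1 ∨ b + 1 ≤ w.re := by
    intro w hw
    rcases hw with ((hw | hw) | hw) | hw
    · rw [hET, mem_reProdIm, mem_Icc, mem_Icc] at hw; exact Or.inl hw.2.1
    · rw [hEL, mem_reProdIm, mem_Icc, mem_Icc] at hw; exact Or.inr (Or.inr (Or.inl hw.1.2))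
    · rw [hEB, mem_reProdIm, mem_Icc, mem_Icc] at hw; exact Or.inr (Or.inl hw.2.2)
    · rw [hER, mem_reProdIm, mem_Icc, mem_Icc] at hw; exact Or.inr (Or.inr (Or.inr hw.1.1))
  -- conversely, the frame contains the boundary of the inner box
  have hEin : ∀ w : ℂ, a - 2 ≤ w.re → w.re ≤ b + 2 → c - 2 ≤ w.im → w.im ≤ d + 2 →
      (d + 1 ≤ w.im ∨ w.im ≤ c - 1 ∨ w.re ≤ a - 1 ∨ b + 1 ≤ w.re) → w ∈ E := by
    intro w h1 h2 h3 h4 hw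
    rcases hw with hw | hw | hw | hw
    · exact Or.inl (Or.inl (Or.inl ((mem_reProdIm).2 ⟨⟨h1, h2⟩, ⟨hw, h4⟩⟩)))
    · exact Or.inl (Or.inr ((mem_reProdIm).2 ⟨⟨h1, h2⟩, ⟨h3, hw⟩⟩))
    · exact Or.inl (Or.inl (Or.inr ((mem_reProdIm).2 ⟨⟨h1, hw⟩, ⟨h3, h4⟩⟩)))
    · exact Or.inr ((mem_reProdIm).2 ⟨⟨hw, h2⟩, ⟨h3, h4⟩⟩)
  -- criteria for not belonging to `A`, `B`
  have hrect : ∀ w ∈ 𝒦, a ≤ w.re ∧ w.re ≤ b ∧ c ≤ w.im ∧ w.im ≤ d := fun w hw => by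
    have h' := h𝒦sub hw
    rw [mem_reProdIm, mem_Icc, mem_Icc] at h'
    exact ⟨h'.1.1, h'.1.2, h'.2.1, h'.2.2⟩
  have hnotA : ∀ w : ℂ, a < w.re → w.re < b + 1 → c - 1 < w.im → w.im < d + 1 →
      (d < w.im ∨ w.im < c ∨ b < w.re) → w ∉ A := by
    intro w h1 h2 h3 h4 h5 hw
    rcases hw with (hw | hw) | hw
    · obtain ⟨-, hr2, hi1, hi2⟩ := hrect w (hZ₁sub hw)
      rcases h5 with h5 | h5 | h5 <;> linarith
    · rw [hLp, mem_reProdIm, mem_singleton_iff] at hw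
      linarith [hw.1]
    · rcases hEout w hw with h6 | h6 | h6 | h6 <;> linarith
  have hnotB : ∀ w : ℂ, a - 1 < w.re → w.re < b → c - 1 < w.im → w.im < d + 1 →
      (d < w.im ∨ w.im < c ∨ w.re < a) → w ∉ B := by
    intro w h1 h2 h3 h4 h5 hw
    rcases hw with (hw | hw) | hw
    · obtain ⟨hr1, -, hi1, hi2⟩ := hrect w (hZ₂sub hw)
      rcases h5 with h5 | h5 | h5 <;> linarith
    · rw [hRp, mem_reProdIm, mem_singleton_iff] at hw
      linarith [hw.1]
    · rcases hEout w hw with h6 | h6 | h6 | h6 <;> linarith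
  -- Step 3: `A ∩ B = E` is connected
  have hABE : A ∩ B = E := by
    refine Subset.antisymm ?_ fun w hw => ⟨Or.inr hw, Or.inr hw⟩
    rintro w ⟨(hwA | hwA) | hwA, (hwB | hwB) | hwB⟩
    · exact absurd hwB (Set.disjoint_left.1 hZdisj hwA)
    · rw [hRp, mem_reProdIm, mem_singleton_iff] at hwB
      exact absurd (show w ∈ {z : ℂ | z.re = b} from hwB.1) (Set.disjoint_left.1 hZ₁b hwA)
    · exact hwB
    · rw [hLp, mem_reProdIm, mem_singleton_iff] at hwA
      exact absurd (show w ∈ {z : ℂ | z.re = a} from hwA.1) (Set.disjoint_left.1 hZ₂a hwB)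
    · rw [hLp, mem_reProdIm, mem_singleton_iff] at hwA
      rw [hRp, mem_reProdIm, mem_singleton_iff] at hwB
      exact absurd (hwA.1.symm.trans hwB.1) hab.ne
    · exact hwB
    · exact hwA
    · exact hwA
    · exact hwA
  have hEconn : IsPreconnected E := by
    have hT : IsPreconnected ET := (convex_Icc_reProdIm_Icc _ _ _ _).isPreconnected
    have hL : IsPreconnected EL := (convex_Icc_reProdIm_Icc _ _ _ _).isPreconnected
    have hB' : IsPreconnected EB := (convex_Icc_reProdIm_Icc _ _ _ _).isPreconnected
    have hR : IsPreconnected ER := (convex_Icc_reProdIm_Icc _ _ _ _).isPreconnected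
    have h1 : IsPreconnected (ET ∪ EL) := by
      refine IsPreconnected.union (((a - 2 : ℝ) : ℂ) + ((d + 2 : ℝ) : ℂ) * I) ?_ ?_ hT hL
      · rw [hET, mem_reProdIm, mem_Icc, mem_Icc]
        simp only [add_re, ofReal_re, mul_re, I_re, mul_zero, ofReal_im, I_im, mul_one,
          sub_self, add_zero, add_im, mul_im, zero_add]
        refine ⟨⟨le_rfl, by linarith⟩, ⟨by linarith, le_rfl⟩⟩
      · rw [hEL, mem_reProdIm, mem_Icc, mem_Icc]
        simp only [add_re, ofReal_re, mul_re, I_re, mul_zero, ofReal_im, I_im, mul_one,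
          sub_self, add_zero, add_im, mul_im, zero_add]
        refine ⟨⟨le_rfl, by linarith⟩, ⟨by linarith, le_rfl⟩⟩
    have h2 : IsPreconnected ((ET ∪ EL) ∪ EB) := by
      refine IsPreconnected.union (((a - 2 : ℝ) : ℂ) + ((c - 2 : ℝ) : ℂ) * I) ?_ ?_ h1 hB'
      · refine Or.inr ?_
        rw [hEL, mem_reProdIm, mem_Icc, mem_Icc]
        simp only [add_re, ofReal_re, mul_re, I_re, mul_zero, ofReal_im, I_im, mul_one,
          sub_self, add_zero, add_im, mul_im, zero_add]
        refine ⟨⟨le_rfl, by linarith⟩, ⟨le_rfl, by linarith⟩⟩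
      · rw [hEB, mem_reProdIm, mem_Icc, mem_Icc]
        simp only [add_re, ofReal_re, mul_re, I_re, mul_zero, ofReal_im, I_im, mul_one,
          sub_self, add_zero, add_im, mul_im, zero_add]
        refine ⟨⟨le_rfl, by linarith⟩, ⟨le_rfl, by linarith⟩⟩
    refine IsPreconnected.union (((b + 2 : ℝ) : ℂ) + ((c - 2 : ℝ) : ℂ) * I) ?_ ?_ h2 hR
    · refine Or.inr ?_
      rw [hEB, mem_reProdIm, mem_Icc, mem_Icc]
      simp only [add_re, ofReal_re, mul_re, I_re, mul_zero, ofReal_im, I_im, mul_one,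
        sub_self, add_zero, add_im, mul_im, zero_add]
      refine ⟨⟨by linarith, le_rfl⟩, ⟨le_rfl, by linarith⟩⟩
    · rw [hER, mem_reProdIm, mem_Icc, mem_Icc]
      simp only [add_re, ofReal_re, mul_re, I_re, mul_zero, ofReal_im, I_im, mul_one,
        sub_self, add_zero, add_im, mul_im, zero_add]
      refine ⟨⟨by linarith, le_rfl⟩, ⟨le_rfl, by linarith⟩⟩
  have hAB : IsPreconnected (A ∩ B) := hABE ▸ hEconn
  -- Step 4: the two points and the two margin paths
  set m : ℝ := (a + b) / 2 with hm
  have hma : a < m := by rw [hm]; linarith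
  have hmb : m < b := by rw [hm]; linarith
  set p : ℂ := ((m : ℝ) : ℂ) + ((d + 1 / 2 : ℝ) : ℂ) * I with hp
  set q : ℂ := ((m : ℝ) : ℂ) + ((c - 1 / 2 : ℝ) : ℂ) * I with hq
  have hre_im : ∀ x y : ℝ, (((x : ℝ) : ℂ) + ((y : ℝ) : ℂ) * I).re = x ∧
      (((x : ℝ) : ℂ) + ((y : ℝ) : ℂ) * I).im = y := fun x y => by
    constructor <;> simp
  -- horizontal and vertical segments as images of intervals
  have hhoriz : ∀ (y x₁ x₂ : ℝ), IsPreconnected ((fun x : ℝ => ((x : ℝ) : ℂ) + ((y : ℝ) : ℂ) * I) ''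
      Icc x₁ x₂) := fun y x₁ x₂ =>
    isPreconnected_Icc.image _ (by fun_prop : Continuous fun x : ℝ =>
      ((x : ℝ) : ℂ) + ((y : ℝ) : ℂ) * I).continuousOn
  have hvert : ∀ (x y₁ y₂ : ℝ), IsPreconnected ((fun y : ℝ => ((x : ℝ) : ℂ) + ((y : ℝ) : ℂ) * I) ''
      Icc y₁ y₂) := fun x y₁ y₂ =>
    isPreconnected_Icc.image _ (by fun_prop : Continuous fun y : ℝ =>
      ((x : ℝ) : ℂ) + ((y : ℝ) : ℂ) * I).continuousOn
  -- the right margin path misses `A`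
  have hSA : ∃ S ⊆ Aᶜ, IsPreconnected S ∧ p ∈ S ∧ q ∈ S := by
    set S₁ := (fun x : ℝ => ((x : ℝ) : ℂ) + ((d + 1 / 2 : ℝ) : ℂ) * I) '' Icc m (b + 1 / 2)
    set S₂ := (fun y : ℝ => (((b + 1 / 2 : ℝ) : ℝ) : ℂ) + ((y : ℝ) : ℂ) * I) ''
      Icc (c - 1 / 2) (d + 1 / 2)
    set S₃ := (fun x : ℝ => ((x : ℝ) : ℂ) + ((c - 1 / 2 : ℝ) : ℂ) * I) '' Icc m (b + 1 / 2)
    refine ⟨(S₁ ∪ S₂) ∪ S₃, ?_, ?_, ?_, ?_⟩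
    · rintro w ((⟨x, hx, rfl⟩ | ⟨y, hy, rfl⟩) | ⟨x, hx, rfl⟩)
      · rw [mem_Icc] at hx
        refine hnotA _ ?_ ?_ ?_ ?_ (Or.inl ?_) <;>
          simp only [(hre_im _ _).1, (hre_im _ _).2] <;> linarith
      · rw [mem_Icc] at hy
        refine hnotA _ ?_ ?_ ?_ ?_ (Or.inr (Or.inr ?_)) <;>
          simp only [(hre_im _ _).1, (hre_im _ _).2] <;> linarith
      · rw [mem_Icc] at hx
        refine hnotA _ ?_ ?_ ?_ ?_ (Or.inr (Or.inl ?_)) <;>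
          simp only [(hre_im _ _).1, (hre_im _ _).2] <;> linarith
    · refine IsPreconnected.union ((((b + 1 / 2 : ℝ) : ℝ) : ℂ) + ((c - 1 / 2 : ℝ) : ℂ) * I)
        (Or.inr ⟨c - 1 / 2, ⟨le_rfl, by linarith⟩, rfl⟩) ⟨b + 1 / 2, ⟨by linarith, le_rfl⟩, rfl⟩
        ?_ (hhoriz _ _ _)
      exact IsPreconnected.union ((((b + 1 / 2 : ℝ) : ℝ) : ℂ) + ((d + 1 / 2 : ℝ) : ℂ) * I)
        ⟨b + 1 / 2, ⟨by linarith, le_rfl⟩, rfl⟩ ⟨d + 1 / 2, ⟨by linarith, le_rfl⟩, rfl⟩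
        (hhoriz _ _ _) (hvert _ _ _)
    · exact Or.inl (Or.inl ⟨m, ⟨le_rfl, by linarith⟩, rfl⟩)
    · exact Or.inr ⟨m, ⟨le_rfl, by linarith⟩, rfl⟩
  -- the left margin path misses `B`
  have hSB : ∃ S ⊆ Bᶜ, IsPreconnected S ∧ p ∈ S ∧ q ∈ S := by
    set S₁ := (fun x : ℝ => ((x : ℝ) : ℂ) + ((d + 1 / 2 : ℝ) : ℂ) * I) '' Icc (a - 1 / 2) m
    set S₂ := (fun y : ℝ => (((a - 1 / 2 : ℝ) : ℝ) : ℂ) + ((y : ℝ) : ℂ) * I) ''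
      Icc (c - 1 / 2) (d + 1 / 2)
    set S₃ := (fun x : ℝ => ((x : ℝ) : ℂ) + ((c - 1 / 2 : ℝ) : ℂ) * I) '' Icc (a - 1 / 2) m
    refine ⟨(S₁ ∪ S₂) ∪ S₃, ?_, ?_, ?_, ?_⟩
    · rintro w ((⟨x, hx, rfl⟩ | ⟨y, hy, rfl⟩) | ⟨x, hx, rfl⟩)
      · rw [mem_Icc] at hx
        refine hnotB _ ?_ ?_ ?_ ?_ (Or.inl ?_) <;>
          simp only [(hre_im _ _).1, (hre_im _ _).2] <;> linarith
      · rw [mem_Icc] at hy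
        refine hnotB _ ?_ ?_ ?_ ?_ (Or.inr (Or.inr ?_)) <;>
          simp only [(hre_im _ _).1, (hre_im _ _).2] <;> linarith
      · rw [mem_Icc] at hx
        refine hnotB _ ?_ ?_ ?_ ?_ (Or.inr (Or.inl ?_)) <;>
          simp only [(hre_im _ _).1, (hre_im _ _).2] <;> linarith
    · refine IsPreconnected.union ((((a - 1 / 2 : ℝ) : ℝ) : ℂ) + ((c - 1 / 2 : ℝ) : ℂ) * I)
        (Or.inr ⟨c - 1 / 2, ⟨le_rfl, by linarith⟩, rfl⟩) ⟨a - 1 / 2, ⟨le_rfl, by linarith⟩, rfl⟩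
        ?_ (hhoriz _ _ _)
      exact IsPreconnected.union ((((a - 1 / 2 : ℝ) : ℝ) : ℂ) + ((d + 1 / 2 : ℝ) : ℂ) * I)
        ⟨a - 1 / 2, ⟨le_rfl, by linarith⟩, rfl⟩ ⟨d + 1 / 2, ⟨by linarith, le_rfl⟩, rfl⟩
        (hhoriz _ _ _) (hvert _ _ _)
    · exact Or.inl (Or.inl ⟨m, ⟨by linarith, le_rfl⟩, rfl⟩)
    · exact Or.inr ⟨m, ⟨by linarith, le_rfl⟩, rfl⟩
  -- Step 5: Janiszewski, and a path from `p` to `q` off `A ∪ B`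
  obtain ⟨S, hS, hSc, hpS, hqS⟩ := janiszewski' hAc hBc hAB hSA hSB
  have hUo : IsOpen (A ∪ B)ᶜ := (hAc.union hBc).isClosed.isOpen_compl
  obtain ⟨γ₁, hγ₁⟩ := joinedIn_of_isPreconnected hUo hSc hS hpS hqS
  set g : ℝ → ℂ := fun t => γ₁.extend t with hg
  have hgc : Continuous g := γ₁.continuous_extend
  have hgU : ∀ t, g t ∈ (A ∪ B)ᶜ := fun t => by
    have ht : g t ∈ range γ₁.extend := ⟨t, rfl⟩
    rw [Path.extend_range] at ht
    obtain ⟨s, hs⟩ := ht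
    rw [← hs]
    exact hγ₁ s
  have hg0 : g 0 = p := γ₁.extend_zero
  have hg1 : g 1 = q := γ₁.extend_one
  -- Step 6: the path stays in the inner open box and strictly between `re = a`, `re = b`
  have hbox : ∀ t, g t ∈ Ioo (a - 1) (b + 1) ×ℂ Ioo (c - 1) (d + 1) := by
    have hsub : range g ⊆ (Ioo (a - 1) (b + 1) ×ℂ Ioo (c - 1) (d + 1)) ∪
        (Icc (a - 2) (b + 2) ×ℂ Icc (c - 2) (d + 2))ᶜ := by
      rintro _ ⟨t, rfl⟩
      by_cases h1 : g t ∈ Icc (a - 2) (b + 2) ×ℂ Icc (c - 2) (d + 2)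
      · left
        rw [mem_reProdIm, mem_Icc, mem_Icc] at h1
        by_contra h2
        rw [mem_reProdIm, mem_Ioo, mem_Ioo] at h2
        have hE' : g t ∈ E := by
          refine hEin (g t) h1.1.1 h1.1.2 h1.2.1 h1.2.2 ?_
          by_contra h3
          push Not at h3
          exact h2 ⟨⟨by linarith [h3.2.2.1], by linarith [h3.2.2.2]⟩,
            ⟨by linarith [h3.2.1], by linarith [h3.1]⟩⟩
        exact hgU t (Or.inl (Or.inr hE'))
      · exact Or.inr h1
    have hdisj : Disjoint (Ioo (a - 1) (b + 1) ×ℂ Ioo (c - 1) (d + 1))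
        (Icc (a - 2) (b + 2) ×ℂ Icc (c - 2) (d + 2))ᶜ := by
      rw [Set.disjoint_compl_right_iff_subset]
      intro w hw
      rw [mem_reProdIm, mem_Ioo, mem_Ioo] at hw
      rw [mem_reProdIm, mem_Icc, mem_Icc]
      exact ⟨⟨by linarith [hw.1.1], by linarith [hw.1.2]⟩,
        ⟨by linarith [hw.2.1], by linarith [hw.2.2]⟩⟩
    have hp_in : p ∈ Ioo (a - 1) (b + 1) ×ℂ Ioo (c - 1) (d + 1) := by
      rw [hp, mem_reProdIm, mem_Ioo, mem_Ioo, (hre_im _ _).1, (hre_im _ _).2]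
      exact ⟨⟨by linarith, by linarith⟩, ⟨by linarith, by linarith⟩⟩
    rcases (isPreconnected_range hgc).subset_or_subset (isOpen_Ioo.reProdIm isOpen_Ioo)
      (isClosed_Icc.reProdIm isClosed_Icc).isOpen_compl hdisj hsub with hcase | hcase
    · exact fun t => hcase ⟨t, rfl⟩
    · exact absurd (Set.disjoint_left.1 hdisj hp_in) (not_not.2 (hcase ⟨0, hg0⟩))
  have hre : ∀ t, a < (g t).re ∧ (g t).re < b := by
    have hne_a : ∀ t, (g t).re ≠ a := fun t hta => by
      have hb := hbox t
      rw [mem_reProdIm, mem_Ioo, mem_Ioo] at hb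
      refine hgU t (Or.inl (Or.inl (Or.inr ?_)))
      rw [hLp, mem_reProdIm, mem_singleton_iff, mem_Icc]
      exact ⟨hta, hb.2.1.le, hb.2.2.le⟩
    have hne_b : ∀ t, (g t).re ≠ b := fun t htb => by
      have hb := hbox t
      rw [mem_reProdIm, mem_Ioo, mem_Ioo] at hb
      refine hgU t (Or.inr (Or.inl (Or.inr ?_)))
      rw [hRp, mem_reProdIm, mem_singleton_iff, mem_Icc]
      exact ⟨htb, hb.2.1.le, hb.2.2.le⟩
    have hg0re : (g 0).re = m := by rw [hg0, hp, (hre_im _ _).1]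
    have hf : Continuous fun t => (g t).re := continuous_re.comp hgc
    intro t
    constructor
    · by_contra hle
      push Not at hle
      obtain ⟨s, hs⟩ := intermediate_value_univ t 0 hf ⟨hle, by rw [hg0re]; exact hma.le⟩
      exact hne_a s hs
    · by_contra hle
      push Not at hle
      obtain ⟨s, hs⟩ := intermediate_value_univ 0 t hf ⟨by rw [hg0re]; exact hmb.le, hle⟩
      exact hne_b s hs
  -- Step 7: the last visit to `im ≥ d` and the next visit to `im ≤ c`
  set f : ℝ → ℝ := fun t => (g t).im with hf
  have hfc : Continuous f := continuous_im.comp hgc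
  have hf0 : f 0 = d + 1 / 2 := by simp only [hf]; rw [hg0, hp, (hre_im _ _).2]
  have hf1 : f 1 = c - 1 / 2 := by simp only [hf]; rw [hg1, hq, (hre_im _ _).2]
  set T₁ : Set ℝ := Icc 0 1 ∩ {t | d ≤ f t} with hT₁
  have hT₁c : IsClosed T₁ := isClosed_Icc.inter (isClosed_le continuous_const hfc)
  have hT₁ne : T₁.Nonempty := ⟨0, ⟨le_rfl, zero_le_one⟩, by show d ≤ f 0; rw [hf0]; linarith⟩
  have hT₁bdd : BddAbove T₁ := ⟨1, fun t ht => ht.1.2⟩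
  set t₁ := sSup T₁ with ht₁
  have ht₁mem : t₁ ∈ T₁ := hT₁c.csSup_mem hT₁ne hT₁bdd
  have ht₁I : t₁ ∈ Icc (0 : ℝ) 1 := ht₁mem.1
  have hafter₁ : ∀ t, t₁ < t → t ≤ 1 → f t < d := fun t ht ht1 => by
    by_contra hge
    push Not at hge
    exact not_le.2 ht (le_csSup hT₁bdd ⟨⟨ht₁I.1.trans ht.le, ht1⟩, hge⟩)
  have hft₁ : f t₁ = d := by
    have hmem : d ∈ Icc (f 1) (f t₁) := ⟨by rw [hf1]; linarith, ht₁mem.2⟩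
    obtain ⟨s, hs, hfs⟩ := intermediate_value_Icc' ht₁I.2 hfc.continuousOn hmem
    have hsT : s ∈ T₁ := ⟨⟨ht₁I.1.trans hs.1, hs.2⟩, hfs.ge⟩
    have hst : s = t₁ := le_antisymm (le_csSup hT₁bdd hsT) hs.1
    rw [← hst, hfs]
  set T₂ : Set ℝ := Icc t₁ 1 ∩ {t | f t ≤ c} with hT₂
  have hT₂c : IsClosed T₂ := isClosed_Icc.inter (isClosed_le hfc continuous_const)
  have hT₂ne : T₂.Nonempty := ⟨1, ⟨ht₁I.2, le_rfl⟩, by show f 1 ≤ c; rw [hf1]; linarith⟩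
  have hT₂bdd : BddBelow T₂ := ⟨t₁, fun t ht => ht.1.1⟩
  set t₂ := sInf T₂ with ht₂
  have ht₂mem : t₂ ∈ T₂ := hT₂c.csInf_mem hT₂ne hT₂bdd
  have ht₁₂ : t₁ ≤ t₂ := ht₂mem.1.1
  have ht₂1 : t₂ ≤ 1 := ht₂mem.1.2
  have hbefore₂ : ∀ t, t₁ ≤ t → t < t₂ → c < f t := fun t ht ht' => by
    by_contra hle
    push Not at hle
    exact not_le.2 ht' (csInf_le hT₂bdd ⟨⟨ht, ht'.le.trans ht₂1⟩, hle⟩)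
  have hft₂ : f t₂ = c := by
    have hmem : c ∈ Icc (f t₂) (f t₁) := ⟨ht₂mem.2, by rw [hft₁]; exact hcd.le⟩
    obtain ⟨s, hs, hfs⟩ := intermediate_value_Icc' ht₁₂ hfc.continuousOn hmem
    have hsT : s ∈ T₂ := ⟨⟨hs.1, hs.2.trans ht₂1⟩, hfs.le⟩
    have hst : s = t₂ := le_antisymm hs.2 (csInf_le hT₂bdd hsT)
    rw [← hst, hfs]
  have hband : ∀ t, t₁ ≤ t → t ≤ t₂ → c ≤ f t ∧ f t ≤ d := fun t h1 h2 => by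
    constructor
    · rcases h2.lt_or_eq with h2 | rfl
      · exact (hbefore₂ t h1 h2).le
      · exact hft₂.ge
    · rcases h1.lt_or_eq with h1 | rfl
      · exact (hafter₁ t h1 (h2.trans ht₂1)).le
      · exact hft₁.le
  -- Step 8: the dual path, reparametrised by `[0, 1]` from the bottom to the top
  refine ⟨fun u => g (t₂ + (t₁ - t₂) * u), (hgc.comp (by fun_prop)).continuousOn,
    fun u hu => ?_, ?_, ?_, fun u hu => ?_⟩
  · have hu' : t₁ ≤ t₂ + (t₁ - t₂) * u ∧ t₂ + (t₁ - t₂) * u ≤ t₂ := by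
      rw [mem_Icc] at hu
      constructor <;> nlinarith [hu.1, hu.2, ht₁₂]
    obtain ⟨h1, h2⟩ := hband _ hu'.1 hu'.2
    obtain ⟨h3, h4⟩ := hre (t₂ + (t₁ - t₂) * u)
    rw [mem_reProdIm, mem_Icc, mem_Icc]
    exact ⟨⟨h3.le, h4.le⟩, ⟨h1, h2⟩⟩
  · show f (t₂ + (t₁ - t₂) * 0) = c
    rw [mul_zero, add_zero, hft₂]
  · show f (t₂ + (t₁ - t₂) * 1) = d
    rw [mul_one, add_sub_cancel, hft₁]
  · intro hmem
    have hAB' : g (t₂ + (t₁ - t₂) * u) ∈ A ∪ B := by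
      rw [← hZunion] at hmem
      rcases hmem with hm1 | hm2
      · exact Or.inl (Or.inl (Or.inl hm1))
      · exact Or.inr (Or.inl (Or.inl hm2))
    exact hgU _ hAB'

end Literature.Topology.PlaneTopology
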